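import Summits.SmoothPoincare4.SmoothPoincare4.Theorems.SymplecticOrigamiFoldedSphereFoldExistenceTransport
import Summits.SmoothPoincare4.SmoothPoincare4.Theorems.SymplecticOrigamiFoldedSphereFoldExistenceFoldModel
import Literature.Geometry.Symplectic.GromovR4StdModel
import Literature.Topology.FourManifolds.ImmersionCriterion

/-!
# The pull-back of `ω₀` by a map folding along a chart 3-sphere is a folded symplectic form

Helper file for item `FoldedSphereFoldExistence` (route SymplecticOrigami): the LAST STEP of the
printed proof. Cannas da Silva, *Fold-forms for four-folds* (J. Symplectic Geom. 8 (2010)), §1: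
"The pullback of a symplectic form by a `Z`-immersion is a folded symplectic form with folding
hypersurface `Z`" (= Lemma 4 there for the trivial foliation; Gromov, *Partial Differential
Relations* (1986), §2.1.3). A `Z`-immersion ("map folding along `Z`") `f : M → ℝ⁴` is regular off
the hypersurface `Z` and, near each point of `Z`, reads `(u₀, u₁, u₂, u₃) ↦ (u₀², u₁, u₂, u₃)` in
charts of `M` and `ℝ⁴`, with `Z = {u₀ = 0}`. This file: the chart-level calculus (differentials
of charts of the maximal atlas, factorisation of `df` in a fold chart, the kernel vector
`∂/∂u₀` on the fold).
-/

noncomputable section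

-- the prescribed namespace `Summit.<P>.<Sub>.…` duplicates `SmoothPoincare4` (P = Sub)
set_option linter.dupNamespace false

open scoped Manifold ContDiff Topology
open Set Function Metric
open Literature.Geometry.Symplectic Literature.Geometry.Kaehler

namespace Summit.SmoothPoincare4.SmoothPoincare4.Theorems.FoldedSphereFoldExistence

variable {M : Type*} [TopologicalSpace M] [ChartedSpace (EuclideanSpace ℝ (Fin 4)) M]
  [IsManifold (𝓡 4) ∞ M]

/-! ### Charts of the maximal atlas are differentiable partial homeomorphisms -/

/-- A chart of the maximal `C^∞` atlas is an `MDifferentiable` partial homeomorphism (so its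
differentials are linear isomorphisms, `OpenPartialHomeomorph.MDifferentiable.mfderiv`).
[folklore] -/
theorem mdifferentiable_of_mem_maximalAtlas' {N : Type*} [TopologicalSpace N]
    [ChartedSpace (EuclideanSpace ℝ (Fin 4)) N] [IsManifold (𝓡 4) ∞ N]
    {φ : OpenPartialHomeomorph N (EuclideanSpace ℝ (Fin 4))}
    (hφ : φ ∈ IsManifold.maximalAtlas (𝓡 4) ∞ N) : φ.MDifferentiable (𝓡 4) (𝓡 4) :=
  ⟨(contMDiffOn_of_mem_maximalAtlas hφ).mdifferentiableOn (by simp),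
    (contMDiffOn_symm_of_mem_maximalAtlas hφ).mdifferentiableOn (by simp)⟩

/-- For a chart `ψ` of the maximal `C^∞` atlas of the model space `ℝ⁴` and `z ∈ ψ.source`, the
derivative `D(ψ⁻¹)` at `ψ z` is an invertible linear map, hence has non-zero determinant and is
injective. [folklore] -/
theorem det_fderiv_symm_ne_zero_of_mem_maximalAtlas
    {ψ : OpenPartialHomeomorph (EuclideanSpace ℝ (Fin 4)) (EuclideanSpace ℝ (Fin 4))}
    (hψ : ψ ∈ IsManifold.maximalAtlas (𝓡 4) ∞ (EuclideanSpace ℝ (Fin 4))) {z : EuclideanSpace ℝ (Fin 4)}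
    (hz : z ∈ ψ.source) :
    LinearMap.det ((fderiv ℝ ψ.symm (ψ z) : EuclideanSpace ℝ (Fin 4) →L[ℝ] EuclideanSpace ℝ (Fin 4)) :
      EuclideanSpace ℝ (Fin 4) →ₗ[ℝ] EuclideanSpace ℝ (Fin 4)) ≠ 0 ∧
      Injective (fderiv ℝ ψ.symm (ψ z)) := by
  have hmd := mdifferentiable_of_mem_maximalAtlas' hψ
  set L := hmd.mfderiv hz with hL_def
  have hL : ∀ w, L.symm w = fderiv ℝ ψ.symm (ψ z) w := fun w => by
    show mfderiv 𝓘(ℝ, EuclideanSpace ℝ (Fin 4)) 𝓘(ℝ, EuclideanSpace ℝ (Fin 4)) ψ.symm (ψ z) w = _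
    rw [mfderiv_eq_fderiv]
    rfl
  have hLeq : (L.symm : TangentSpace (𝓡 4) (ψ z) →L[ℝ] TangentSpace (𝓡 4) z) =
      fderiv ℝ ψ.symm (ψ z) := by
    ext1 w
    exact hL w
  constructor
  · have hu := L.symm.toLinearEquiv.isUnit_det'
    have h1 : LinearMap.det (L.symm.toLinearEquiv : TangentSpace (𝓡 4) (ψ z) →ₗ[ℝ]
        TangentSpace (𝓡 4) z) = LinearMap.det ((fderiv ℝ ψ.symm (ψ z) :
          EuclideanSpace ℝ (Fin 4) →L[ℝ] EuclideanSpace ℝ (Fin 4)) :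
            EuclideanSpace ℝ (Fin 4) →ₗ[ℝ] EuclideanSpace ℝ (Fin 4)) := by
      rw [← hLeq]
      rfl
    rw [h1] at hu
    exact hu.ne_zero
  · intro v w hvw
    rw [← hL, ← hL] at hvw
    exact L.symm.injective hvw

/-! ### The differential of a folding map in a fold chart -/

/-- **Factorisation of `df` in a fold chart.** If `ψ ∘ f = F ∘ φ` on `φ.source` for the fold
model `F(u) = u + (u₀² - u₀) e₀`, charts `φ` of `M` and `ψ` of `ℝ⁴` (maximal atlas), then at
`x ∈ φ.source`, `df_x = D(ψ⁻¹)_{ψ(f x)} ∘ T(φ x) ∘ dφ_x` with `T` the fold-model derivative.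
[folklore] -/
theorem mfderiv_foldMap_apply {f : M → EuclideanSpace ℝ (Fin 4)}
    {φ : OpenPartialHomeomorph M (EuclideanSpace ℝ (Fin 4))}
    {ψ : OpenPartialHomeomorph (EuclideanSpace ℝ (Fin 4)) (EuclideanSpace ℝ (Fin 4))}
    (hφ : φ ∈ IsManifold.maximalAtlas (𝓡 4) ∞ M)
    (hψ : ψ ∈ IsManifold.maximalAtlas (𝓡 4) ∞ (EuclideanSpace ℝ (Fin 4)))
    (hsrc : φ.source ⊆ f ⁻¹' ψ.source)
    (hnf : ∀ x ∈ φ.source, ψ (f x) = φ x + ((φ x 0) ^ 2 - φ x 0) •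
      EuclideanSpace.single (0 : Fin 4) (1 : ℝ))
    {x : M} (hx : x ∈ φ.source) (v : TangentSpace (𝓡 4) x) :
    mfderiv (𝓡 4) (𝓡 4) f x v = fderiv ℝ ψ.symm (ψ (f x))
      ((ContinuousLinearMap.id ℝ (EuclideanSpace ℝ (Fin 4)) +
        ((2 * φ x 0 - 1) • (EuclideanSpace.proj (0 : Fin 4) : EuclideanSpace ℝ (Fin 4) →L[ℝ] ℝ)).smulRight
          (EuclideanSpace.single (0 : Fin 4) (1 : ℝ))) (mfderiv (𝓡 4) (𝓡 4) φ x v)) := by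
  have hn : (∞ : ℕ∞ω) ≠ 0 := by simp
  set F : EuclideanSpace ℝ (Fin 4) → EuclideanSpace ℝ (Fin 4) := fun u =>
    u + ((u 0) ^ 2 - u 0) • EuclideanSpace.single (0 : Fin 4) (1 : ℝ) with hF
  have hψs' : ContDiffOn ℝ ∞ ψ.symm ψ.target :=
    contMDiffOn_iff_contDiffOn.1 (contMDiffOn_symm_of_mem_maximalAtlas hψ)
  -- `f = ψ⁻¹ ∘ F ∘ φ` near `x`
  have hloc : f =ᶠ[𝓝 x] ((fun u => ψ.symm (F u)) ∘ φ) := by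
    filter_upwards [φ.open_source.mem_nhds hx] with y hy
    have h1 : ψ (f y) = F (φ y) := hnf y hy
    show f y = ψ.symm (F (φ y))
    rw [← h1, ψ.left_inv (hsrc hy)]
  -- chain rule
  have hφd : MDifferentiableAt (𝓡 4) (𝓡 4) φ x :=
    (mdifferentiable_of_mem_maximalAtlas' hφ).mdifferentiableAt hx
  have hFx : F (φ x) = ψ (f x) := (hnf x hx).symm
  have hFt : F (φ x) ∈ ψ.target := by rw [hFx]; exact ψ.map_source (hsrc hx)
  have hFd : DifferentiableAt ℝ F (φ x) := (hasFDerivAt_foldModel (φ x)).differentiableAt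
  have hαd : DifferentiableAt ℝ ψ.symm (F (φ x)) :=
    (hψs'.contDiffAt (ψ.open_target.mem_nhds hFt)).differentiableAt (by simp)
  have hGd : MDifferentiableAt (𝓡 4) (𝓡 4) (fun u => ψ.symm (F u)) (φ x) :=
    (hαd.comp (φ x) hFd).mdifferentiableAt
  have h1 : mfderiv (𝓡 4) (𝓡 4) ((fun u => ψ.symm (F u)) ∘ φ) x =
      (mfderiv (𝓡 4) (𝓡 4) (fun u => ψ.symm (F u)) (φ x)).comp (mfderiv (𝓡 4) (𝓡 4) φ x) :=
    mfderiv_comp x hGd hφd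
  have h2 : mfderiv (𝓡 4) (𝓡 4) (fun u => ψ.symm (F u)) (φ x) =
      (fderiv ℝ ψ.symm (F (φ x))).comp (fderiv ℝ F (φ x)) := by
    rw [mfderiv_eq_fderiv]
    exact fderiv_comp (φ x) hαd hFd
  have h3 : fderiv ℝ F (φ x) = ContinuousLinearMap.id ℝ (EuclideanSpace ℝ (Fin 4)) +
      ((2 * φ x 0 - 1) • (EuclideanSpace.proj (0 : Fin 4) : EuclideanSpace ℝ (Fin 4) →L[ℝ] ℝ)).smulRight
        (EuclideanSpace.single (0 : Fin 4) (1 : ℝ)) := (hasFDerivAt_foldModel (φ x)).fderiv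
  rw [hloc.mfderiv_eq]
  have h4 : mfderiv (𝓡 4) (𝓡 4) ((fun u => ψ.symm (F u)) ∘ φ) x v =
      mfderiv (𝓡 4) (𝓡 4) (fun u => ψ.symm (F u)) (φ x) (mfderiv (𝓡 4) (𝓡 4) φ x v) :=
    congrArg (fun T => T v) h1
  have h5 : mfderiv (𝓡 4) (𝓡 4) (fun u => ψ.symm (F u)) (φ x) (mfderiv (𝓡 4) (𝓡 4) φ x v) =
      fderiv ℝ ψ.symm (F (φ x)) (fderiv ℝ F (φ x) (mfderiv (𝓡 4) (𝓡 4) φ x v)) :=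
    congrArg (fun T => T (mfderiv (𝓡 4) (𝓡 4) φ x v)) h2
  refine h4.trans (h5.trans ?_)
  rw [h3, hFx]

/-- `ω₀(0, b) = 0`. [folklore] -/
theorem stdSymplecticForm_zero_left (b : EuclideanSpace ℝ (Fin 4)) : stdSymplecticForm 0 b = 0 := by
  simp [stdSymplecticForm]

/-- **Kernel of `f^*ω₀` on the fold.** In a fold chart, at a point `x` with `(φ x)₀ = 0`, the
vector `v = d(φ⁻¹) e₀` is a non-zero kernel vector of `(f^*ω₀)_x` (since `df_x v = 0`) with
`dφ_x v = e₀`. [folklore] -/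
theorem exists_kernel_of_foldChart {f : M → EuclideanSpace ℝ (Fin 4)}
    {φ : OpenPartialHomeomorph M (EuclideanSpace ℝ (Fin 4))}
    {ψ : OpenPartialHomeomorph (EuclideanSpace ℝ (Fin 4)) (EuclideanSpace ℝ (Fin 4))}
    (hφ : φ ∈ IsManifold.maximalAtlas (𝓡 4) ∞ M)
    (hψ : ψ ∈ IsManifold.maximalAtlas (𝓡 4) ∞ (EuclideanSpace ℝ (Fin 4)))
    (hsrc : φ.source ⊆ f ⁻¹' ψ.source)
    (hnf : ∀ x ∈ φ.source, ψ (f x) = φ x + ((φ x 0) ^ 2 - φ x 0) •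
      EuclideanSpace.single (0 : Fin 4) (1 : ℝ))
    {x : M} (hx : x ∈ φ.source) (hx0 : φ x 0 = 0) :
    ∃ v : TangentSpace (𝓡 4) x, v ≠ 0 ∧ mfderiv (𝓡 4) (𝓡 4) φ x v =
      EuclideanSpace.single (0 : Fin 4) (1 : ℝ) ∧ mfderiv (𝓡 4) (𝓡 4) f x v = 0 ∧
      ∀ w, stdSymplecticMForm.pullback (𝓡 4) f x ![v, w] = 0 := by
  have hmd := mdifferentiable_of_mem_maximalAtlas' hφ
  set L := hmd.mfderiv hx with hL_def
  have hL : ∀ u, L u = mfderiv (𝓡 4) (𝓡 4) φ x u := fun u => rfl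
  set v : TangentSpace (𝓡 4) x := L.symm (EuclideanSpace.single (0 : Fin 4) (1 : ℝ)) with hv
  have hφv : mfderiv (𝓡 4) (𝓡 4) φ x v = EuclideanSpace.single (0 : Fin 4) (1 : ℝ) := by
    rw [← hL, hv, L.apply_symm_apply]
  have hne : v ≠ 0 := by
    intro h0
    have h1 : (EuclideanSpace.single (0 : Fin 4) (1 : ℝ) : EuclideanSpace ℝ (Fin 4)) = 0 :=
      calc (EuclideanSpace.single (0 : Fin 4) (1 : ℝ) : EuclideanSpace ℝ (Fin 4))
          = mfderiv (𝓡 4) (𝓡 4) φ x v := hφv.symm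
        _ = mfderiv (𝓡 4) (𝓡 4) φ x 0 := by rw [h0]
        _ = 0 := map_zero _
    simpa using congrArg (fun z : EuclideanSpace ℝ (Fin 4) => z 0) h1
  have hdf : mfderiv (𝓡 4) (𝓡 4) f x v = 0 := by
    rw [mfderiv_foldMap_apply hφ hψ hsrc hnf hx v, hφv, foldModelDeriv_single_eq_zero hx0, map_zero]
    rfl
  refine ⟨v, hne, hφv, hdf, fun w => ?_⟩
  rw [stdSymplecticMForm_pullback_apply, hdf]
  exact stdSymplecticForm_zero_left _

end Summit.SmoothPoincare4.SmoothPoincare4.Theorems.FoldedSphereFoldExistence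

end
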